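import Summits.BirchSwinnertonDyer.BirchSwinnertonDyer.Theorems.KimAtThreeTwoExponentWitnessPairU
import Summits.BirchSwinnertonDyer.BirchSwinnertonDyer.Theorems.KimAtThreeDeepLowerKolyvaginPairStable
import HarnessLib

/-!
# Route `KimAtThreeKolyvagin` (rung W2), the `t ≥ 1` additive rows of crux 19679 (`DeepLowerAtThreeOffKatoStratum`,
# stub `stub_additiveDefect`): ★★-stable — the TWO-DEPTH two-exponent Kato–Kurihara witness package from Kato's
# Euler system at ANY `3`-torsion of `E(ℚ₃)` (THEOREM D-u PAIR-STABLE + (COMP)), modulo the value rows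

Cell `bsd-addord`, seat `bsd-addord-w2-acc3` gen 4 (PROGRAMME PART 1b, plan g16 ACCEL-LIST (3)); `--supports`
stmt-BirchSwinnertonDyer-19679 (helper; the item OWNER assembles).  TOOL THEOREM ONLY: no definition, no named
fact, no instance, no `sorry`; Kato's `ZetaBody` (witnesses BOUND, never obtained), the finite-level (Λ)-clauses,
the TWO-EXPONENT rider clause (ii₂) at the two depths and the per-level VALUE rows enter as DISPLAYED hypotheses;
nothing asserted; nothing booked; crux 19679 stays OPEN.

## What and why

This seat's gen-3 ★★-u (`KimAtThreeTwoExponentWitnessPairU.exists_katoKuriharaWitnessAtTwoExp_pair_of_zetaBody_of_unramified`,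
p477319) derives the two-depth two-exponent witness package (hence PORT₂, hence the registered stubs of 19599 /
19679 / 19562 on their additive-defect rows) from Kato's `ZetaBody` + THEOREM D-u PAIR, whose binders
`htopk`/`htopm` (`𝓕_can(E[3^{j+1}])₃ = ⊤`) hold only when `E(ℚ₃)[3] = 0`: the `t ≥ 1` additive rows of crux
19679 were therefore left DISPLAYED (line (R₁) of `KimAtThreeOffStratumAdditiveDefectOfFineKato`).  **This file
is ★★-u with `htopk`/`htopm` REPLACED by the torsion-stabilisation binder `hstab` of level `N₀`** (no ℚ_v-point of
order `3^{N₀+1}` over the place(s) of `3`; Mazur–Rubin App. A Prop. A.2 with the depth explicit) and the Kolyvagin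
primes of `D` / `D″` taken of level `3^{k+N₀+1}` / `3^{m+N₀+1}` — the pair coming from this seat's
`KimAtThreeDeepLowerKolyvaginPairStable` (the place `3` paid by auxiliary deeper derivative families).  Every
other binder and the conclusion are ★★-u's, token for token; with `N₀ = 0` it IS ★★-u.  Sequel
(`KimAtThreeTwoExponentPortOfZetaBodyStable`): PORT₂ `KatoKuriharaPortThreeAtWith₂TwoExp W t e v₃ η P` at EVERY
`t` on the rows with `N₀ = t` (the With-guard depth `k + t` supplies exactly the level `k + t + 1`).

HONEST LIMITS: the value rows, the (Λ)-clauses and (ii₂) are hypotheses on BOUND witnesses (CONSTRUCTION-SHAPED,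
never `_holds`); closes nothing; 0 defs / 0 facts.  Credit: acc6 gen 2 (two-exponent chain), w2-c3 gen 5/6
(D-u, StableThree), team n1011 (originals, T-DER-BP); this seat only re-keys.

References: [Kato2004Asterisque] (8.1.3), §8.2, Lemma 8.5, §9.4, Thm. 9.7; [Kim2022StructureSelmer] §2.2.2, §3.2.3,
Thm. 3.6, §3.3–§3.4.1, Thm. 3.13; [MazurRubin2004] Def. 3.1.3, Thm. 3.2.4, App. A (Prop. A.2, Remark A.5);
[Rubin2000] Def. 4.4.1, 4.4.4, Thm. 4.5.1; [Sakamoto2024] Def. 4.1; [Kim2025RefinedTNC] §4.2, §8.1.2; cell memo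
kim3/KIM3-PROOF.md §14 (Theorem A-t, 14.3 (1a)).
-/

set_option autoImplicit false
-- the Theorems namespace of a single-conjunct summit repeats the summit name by design (D-0017)
set_option linter.dupNamespace false

noncomputable section

open scoped NumberField TensorProduct ContRepresentation Classical
open CategoryTheory Field Function Finset IsDedekindDomain NumberField WeierstrassCurve
open Rat.HeightOneSpectrum
open Literature.NumberTheory.GaloisRepresentations Literature.NumberTheory.GaloisCohomology
open Literature.NumberTheory.GaloisRepresentations.DiscreteGaloisModule
open Literature.NumberTheory.EllipticCurves Literature.NumberTheory.EllipticCurves.ModularForms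
open Literature.NumberTheory.EllipticCurves.Kato2004
open Literature.NumberTheory.EllipticCurves.Kato2004.EulerSystemValues
open Summit.BirchSwinnertonDyer.Rank1Residual.GaloisImage
open Summit.BirchSwinnertonDyer.Rank1Residual.GaloisImage.TorsionCoeff
open Summit.BirchSwinnertonDyer.BirchSwinnertonDyer.Theorems.KimAtThreeKolyvaginDefs
open Summit.BirchSwinnertonDyer.BirchSwinnertonDyer.Theorems.KimAtThreeTwoExponentValueLaw
open Summit.BirchSwinnertonDyer.BirchSwinnertonDyer.Theorems

namespace Summit.BirchSwinnertonDyer.BirchSwinnertonDyer.Theorems.KimAtThreeTwoExponentWitnessPairStable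


variable (W : WeierstrassCurve ℚ) [W.IsElliptic] [W.IsGloballyMinimal]
  [ContinuousSMul ℤ_[3] (W.tateModule 3)] [Module.Free ℤ_[3] (W.tateModule 3)]
  [Module.Finite ℤ_[3] (W.tateModule 3)]

/-- Local notation: `𝐃F⟦r, τ⟧ ℓ = Σ_{j<ℓ−1} j·σ_{χ_{m(0,r)}(τ_ℓ)}^j` on the level field `ℚ(ζ_{m(0,r)})`. -/
local notation3 (prettyPrint := false) "𝐃F⟦" r ", " τ "⟧" =>
  fun ℓ : HeightOneSpectrum (𝓞 ℚ) =>
  ∑ j ∈ Finset.range (((primesEquiv ℓ : Nat.Primes) : ℕ) - 1),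
    (j : Module.End ℚ (CyclotomicField (cycLevel 3 0 r) ℚ)) *
      (sigma (cycLevel 3 0 r) (modNCyclotomicCharacter ℚ (cycLevel 3 0 r)
          ((τ : HeightOneSpectrum (𝓞 ℚ) → absoluteGaloisGroup ℚ) ℓ)) :
        CyclotomicField (cycLevel 3 0 r) ℚ →ₐ[ℚ] CyclotomicField (cycLevel 3 0 r) ℚ).toLinearMap ^ j

/-- Local notation: the TWO-EXPONENT rider clause (ii₂) at depth `j`, torsion exponent `t`, defect exponent
`e`, place `v`, for the pair `(Λ, Λf)` — n1011's `KatoExpStarFiniteLevelAt` clause (ii) with the conclusion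
multiplied by `3^e` (see `KimAtThreeTwoExponentValueLaw`). -/
local notation3 (prettyPrint := false) "RIDER₂⟦" W' ", " j ", " t' ", " e' ", " v' ", " Λ' ", " Λf "⟧" =>
  ∀ (r : Finset (HeightOneSpectrum (𝓞 ℚ)))
    (Ψ : H1 (tateRep W' 3) (cycSubgroup 3 0 r) →+
      continuousCohomology 1
        (subgroupRep (WeierstrassCurve.torsionGaloisModule W' (((3 : ℕ) : ℤ) ^ j * ((3 : ℕ) : ℤ))).toTopRep
          (cycSubgroup 3 0 r))),
    (∀ (φ : contOneCocycles (subgroupRep (tateRep W' 3).toTopRep (cycSubgroup 3 0 r)))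
        (ψ : contOneCocycles
          (subgroupRep (WeierstrassCurve.torsionGaloisModule W' (((3 : ℕ) : ℤ) ^ j * ((3 : ℕ) : ℤ))).toTopRep
            (cycSubgroup 3 0 r))),
        (∀ g, ((ψ.1 g : geomTorsion W' (((3 : ℕ) : ℤ) ^ j * ((3 : ℕ) : ℤ))) : geomPoints W') =
          TateModule.proj 3 (j + 1) (φ.1 g)) →
        Ψ (oneCocycleClass _ φ) = oneCocycleClass _ ψ) →
    ∀ (y : H1 (tateRep W' 3) (cycSubgroup 3 0 r))
      (κ₀ : galoisCohomology (WeierstrassCurve.torsionGaloisModule W' (((3 : ℕ) : ℤ) ^ j * ((3 : ℕ) : ℤ))) 1)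
      (s : ℤ_[3]),
      resSubgroup (WeierstrassCurve.torsionGaloisModule W' (((3 : ℕ) : ℤ) ^ j * ((3 : ℕ) : ℤ))).toTopRep
          (cycSubgroup 3 0 r) 1 κ₀ = Ψ y →
      galoisCohomology.localization (WeierstrassCurve.torsionGaloisModule W' (((3 : ℕ) : ℤ) ^ j * ((3 : ℕ) : ℤ)))
          (Sum.inr v') 1 κ₀ ∈ propagatedSelmerStructure W' 3 j (Sum.inr v') →
      (∃ l ∈ cycIntLattice 3 (cycLevel 3 0 r),
          (((3 : ℕ) : ℤ_[3]) ^ t') • Λ' 0 r y - ((s : ℚ_[3]) ⊗ₜ[ℚ] (1 : CyclotomicField (cycLevel 3 0 r) ℚ)) =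
            (((3 : ℕ) : ℤ_[3]) ^ (j + 1)) • (l : ℚ_[3] ⊗[ℚ] CyclotomicField (cycLevel 3 0 r) ℚ)) →
      ((3 ^ e' : ℕ) : ZMod (3 ^ (j + 1))) *
        Λf (galoisCohomology.localization
          (WeierstrassCurve.torsionGaloisModule W' (((3 : ℕ) : ℤ) ^ j * ((3 : ℕ) : ℤ))) (Sum.inr v') 1 κ₀) =
        PadicInt.toZModPow (j + 1) s

set_option backward.isDefEq.respectTransparency false in
/-- **★★-stable: the two-depth TWO-EXPONENT Kato–Kurihara witness package from `ZetaBody`, THEOREM D-u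
PAIR-STABLE and the value rows, at ANY `3`-torsion of `E(ℚ₃)`** (rows with `3`-anomalous bad places `w ≠ 3`
INCLUDED, NO `hbad`): the conclusion of `KatoKuriharaDictionaryThreeAt₂AtTwoExp W t e k m D D″ π v₃` at the
parametrisation datum `P`, with `κ′ = κ`, `κu′ = κu` THE Kolyvagin systems of THEOREM D-u for Kato's Euler system at
depths `k` and `m`.  This seat's ★★-u (`KimAtThreeTwoExponentWitnessPairU`, p477319) TOKEN FOR TOKEN with the
binders `htopk`/`htopm` (`𝓕_can,3 = ⊤`, i.e. `E(ℚ₃)[3] = 0`) REPLACED by the torsion-stabilisation binder `hstab` of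
level `N₀` over `3` and the Kolyvagin primes of `D` / `D″` of level `3^{k+N₀+1}` / `3^{m+N₀+1}`, the pair taken from
`KimAtThreeDeepLowerKolyvaginPairStable.exists_isKolyvaginSystem_pair_propagatedSelmerStructure_of_stable_of_unramified`
(the place `3` paid by auxiliary deeper derivative families, Mazur–Rubin Prop. A.2 with the depth explicit; the
anomalous bad places by the (C2) clause `hbody.2.1` of `ZetaBody`, [MR04] Remark A.5).  Credit: seat acc6 gen 2
(two-exponent chain), seat w2-c3 gen 5/6 (THEOREM D-u, StableThree), cell b2b-bsdres team n1011 (the originals).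
[cite: Kato2004Asterisque, (8.1.3) (p. 180), Lemma 8.5, §9.4 (p. 188) and Thm. 9.7 (p. 189)]
[cite: Kim2022StructureSelmer, Thm. 3.13 and §2.2.2, §3.2.3, §3.3–§3.4.1 (arXiv v3 pp. 12, 16–18, 26–27)]
[cite: MazurRubin2004, Def. 3.1.3, Thm. 3.2.4, App. A Prop. A.2 (pp. 79–80) and Remark A.5] [cite: Rubin2000, Def. 4.4.4 and Thm. 4.5.1]
[cite: Kim2025RefinedTNC, §4.2 and §8.1.2] -/
theorem exists_katoKuriharaWitnessAtTwoExp_pair_of_zetaBody_of_stable_of_unramified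
    {N : ℕ} [NeZero N] (P : ModularParametrizationData W N)
    {ι : (n : ℕ) → (CyclotomicField n ℚ →+* ℂ)} {κK : ℝ}
    {Λ : ∀ (k' : ℕ) (r : Finset (HeightOneSpectrum (𝓞 ℚ))),
      H1 (tateRep W 3) (cycSubgroup 3 k' r) →ₗ[ℤ_[3]] ℚ_[3] ⊗[ℚ] CyclotomicField (cycLevel 3 k' r) ℚ}
    {c d a : ℤ} {A : ℕ}
    {z : ∀ (k' : ℕ) (r : (cyclotomicLevelsRat 3 (badPlaces c d A N)).Ideals),
      H1 (tateRep W 3) ((cyclotomicLevelsRat 3 (badPlaces c d A N)).level k' r.1)}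
    {x : ∀ (k' : ℕ) (r : (cyclotomicLevelsRat 3 (badPlaces c d A N)).Ideals),
      CyclotomicField (cycLevel 3 k' r.1) ℚ}
    (hbody : ZetaBody W 3 P.f ι κK Λ c d a A z x)
    (hirr : W.HasIrreducibleModPGaloisRep 3)
    -- the two depths and THE reduction
    {k m : ℕ} (hkm : k ≤ m)
    (π : (W.torsionGaloisModule (((3 : ℕ) : ℤ) ^ m * ((3 : ℕ) : ℤ))).toContRepresentation →ⁱL
      (W.torsionGaloisModule (((3 : ℕ) : ℤ) ^ k * ((3 : ℕ) : ℤ))).toContRepresentation)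
    (hπ : ∀ y : geomTorsion W (((3 : ℕ) : ℤ) ^ m * ((3 : ℕ) : ℤ)),
      ((π y : geomTorsion W (((3 : ℕ) : ℤ) ^ k * ((3 : ℕ) : ℤ))) : geomPoints W) =
        (((3 : ℕ) : ℤ) ^ (m - k)) • (y : geomPoints W))
    -- the (Λ)-clauses and the two-exponent riders at `v₃ ∣ 3`, depths `k` and `m`, same `Λ`, same `e`
    {t e : ℕ} {v₃ : HeightOneSpectrum (𝓞 ℚ)} (hv₃ : ((3 : ℕ) : 𝓞 ℚ) ∈ v₃.asIdeal)
    {Λk : galoisCohomology ((W.torsionGaloisModule (((3 : ℕ) : ℤ) ^ k * ((3 : ℕ) : ℤ))).toLocal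
      (Sum.inr v₃)) 1 →+ ZMod (3 ^ (k + 1))}
    {Λm : galoisCohomology ((W.torsionGaloisModule (((3 : ℕ) : ℤ) ^ m * ((3 : ℕ) : ℤ))).toLocal
      (Sum.inr v₃)) 1 →+ ZMod (3 ^ (m + 1))}
    (hΛk : (∀ c : ZMod (3 ^ (k + 1)), ∃ x ∈ propagatedSelmerStructure W 3 k (Sum.inr v₃), Λk x = c) ∧
      (∀ x ∈ propagatedSelmerStructure W 3 k (Sum.inr v₃),
        Λk x = 0 ↔ x ∈ W.kummerSelmerStructure (((3 : ℕ) : ℤ) ^ k * ((3 : ℕ) : ℤ)) (Sum.inr v₃)))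
    (hΛm : (∀ c : ZMod (3 ^ (m + 1)), ∃ x ∈ propagatedSelmerStructure W 3 m (Sum.inr v₃), Λm x = c) ∧
      (∀ x ∈ propagatedSelmerStructure W 3 m (Sum.inr v₃),
        Λm x = 0 ↔ x ∈ W.kummerSelmerStructure (((3 : ℕ) : ℤ) ^ m * ((3 : ℕ) : ℤ)) (Sum.inr v₃)))
    (hfin₂k : RIDER₂⟦W, k, t, e, v₃, Λ, Λk⟧) (hfin₂m : RIDER₂⟦W, m, t, e, v₃, Λ, Λm⟧)
    -- the two data, canonical for the SAME `η`, with usable Kolyvagin primes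
    (D : KolyvaginDatum (W.torsionGaloisModule (((3 : ℕ) : ℤ) ^ k * ((3 : ℕ) : ℤ))))
    (hT : D.transverse = cyclotomicTransverse (W.torsionGaloisModule (((3 : ℕ) : ℤ) ^ k * ((3 : ℕ) : ℤ))))
    (D'' : KolyvaginDatum (W.torsionGaloisModule (((3 : ℕ) : ℤ) ^ m * ((3 : ℕ) : ℤ))))
    (hT'' : D''.transverse =
      cyclotomicTransverse (W.torsionGaloisModule (((3 : ℕ) : ℤ) ^ m * ((3 : ℕ) : ℤ))))
    {η : (q : HeightOneSpectrum (𝓞 ℚ)) → (ZMod (Ideal.absNorm q.asIdeal))ˣ}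
    (hD : D.HasCanonicalComparison (3 ^ (k + 1)) η) (hD'' : D''.HasCanonicalComparison (3 ^ (m + 1)) η)
    (hPr : D.primes ⊆ (cyclotomicLevelsRat 3 (badPlaces c d A N)).primes)
    (hPr'' : D''.primes ⊆ (cyclotomicLevelsRat 3 (badPlaces c d A N)).primes)
    -- the torsion-stabilisation level `N₀` over `3` (no `ℚ_v`-point of order `3^{N₀+1}`), replacing ★★-u's
    -- `htopk`/`htopm`; the Kolyvagin primes are taken `N₀` levels deeper (no `hbad`: the anomalous bad places are
    -- served by (C2) = `hbody.2.1`)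
    {N₀ : ℕ}
    (hstab : ∀ v : HeightOneSpectrum (𝓞 ℚ), ((primesEquiv v : Nat.Primes) : ℕ) = 3 →
      ∀ Q : (W.baseChange (v.adicCompletion ℚ)).toAffine.Point, 3 ^ (N₀ + 1) • Q = 0 → 3 ^ N₀ • Q = 0)
    (hKol : ∀ q ∈ D.primes, Kato.IsKolyvaginPrime W 3 (k + N₀ + 1) ((primesEquiv q : Nat.Primes) : ℕ))
    (hKol'' : ∀ q ∈ D''.primes, Kato.IsKolyvaginPrime W 3 (m + N₀ + 1) ((primesEquiv q : Nat.Primes) : ℕ))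
    -- the VALUE ROWS at depth `k` and at depth `m` (T-PK6-VAL's OUT, displayed)
    (hvalk : ∀ σ : HeightOneSpectrum (𝓞 ℚ) → absoluteGaloisGroup ℚ,
      (∀ q, σ q ∈ (adicCompletionPrime ℚ q).inertia (absoluteGaloisGroup ℚ)) →
      (∀ q, modNCyclotomicCharacter ℚ (Ideal.absNorm q.asIdeal) (σ q) = η q) →
      ∀ (r : Finset (HeightOneSpectrum (𝓞 ℚ))) (hr : (↑r : Set _) ⊆ D.primes),
        ∃ (s : ℤ_[3]) (u : (ZMod (3 ^ (k + 1)))ˣ)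
          (ψ : (ℓ : ℕ) → (ZMod ℓ)ˣ →* Multiplicative (ZMod (3 ^ (k + 1)))),
          (∀ q ∈ r, Function.Surjective (ψ (Ideal.absNorm q.asIdeal))) ∧
          (∃ l ∈ cycIntLattice 3 (cycLevel 3 0 r),
            (((3 : ℕ) : ℤ_[3]) ^ t) • ((1 : ℚ_[3]) ⊗ₜ[ℚ]
              ((r.noncommProd 𝐃F⟦r, σ⟧ (ZetaValue.pairwise_commute_fieldDeriv (cycLevel 3 0 r)
                  (fun ℓ => modNCyclotomicCharacter ℚ (cycLevel 3 0 r) (σ ℓ))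
                  (fun ℓ => ((primesEquiv ℓ : Nat.Primes) : ℕ) - 1) r))
                (x 0 ⟨r, fun _ hq => hPr (hr (Finset.mem_coe.2 hq))⟩ +
                  sigma (cycLevel 3 0 r) (-1) (x 0 ⟨r, fun _ hq => hPr (hr (Finset.mem_coe.2 hq))⟩)))) -
              ((s : ℚ_[3]) ⊗ₜ[ℚ] (1 : CyclotomicField (cycLevel 3 0 r) ℚ)) =
            (((3 : ℕ) : ℤ_[3]) ^ (k + 1)) • (l : ℚ_[3] ⊗[ℚ] CyclotomicField (cycLevel 3 0 r) ℚ)) ∧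
          haveI : NeZero (∏ q ∈ r, Ideal.absNorm q.asIdeal) :=
            ⟨Finset.prod_ne_zero_iff.2 fun q _ h => q.ne_bot (Ideal.absNorm_eq_zero_iff.1 h)⟩
          PadicInt.toZModPow (k + 1) s = (u : ZMod (3 ^ (k + 1))) *
            ((3 : ℕ) : ZMod (3 ^ (k + 1))) ^ t *
              kuriharaNumber P.f (3 ^ (k + 1)) (∏ q ∈ r, Ideal.absNorm q.asIdeal) ψ)
    (hvalm : ∀ σ : HeightOneSpectrum (𝓞 ℚ) → absoluteGaloisGroup ℚ,
      (∀ q, σ q ∈ (adicCompletionPrime ℚ q).inertia (absoluteGaloisGroup ℚ)) →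
      (∀ q, modNCyclotomicCharacter ℚ (Ideal.absNorm q.asIdeal) (σ q) = η q) →
      ∀ (r : Finset (HeightOneSpectrum (𝓞 ℚ))) (hr : (↑r : Set _) ⊆ D''.primes),
        ∃ (s : ℤ_[3]) (u : (ZMod (3 ^ (m + 1)))ˣ)
          (ψ : (ℓ : ℕ) → (ZMod ℓ)ˣ →* Multiplicative (ZMod (3 ^ (m + 1)))),
          (∀ q ∈ r, Function.Surjective (ψ (Ideal.absNorm q.asIdeal))) ∧
          (∃ l ∈ cycIntLattice 3 (cycLevel 3 0 r),
            (((3 : ℕ) : ℤ_[3]) ^ t) • ((1 : ℚ_[3]) ⊗ₜ[ℚ]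
              ((r.noncommProd 𝐃F⟦r, σ⟧ (ZetaValue.pairwise_commute_fieldDeriv (cycLevel 3 0 r)
                  (fun ℓ => modNCyclotomicCharacter ℚ (cycLevel 3 0 r) (σ ℓ))
                  (fun ℓ => ((primesEquiv ℓ : Nat.Primes) : ℕ) - 1) r))
                (x 0 ⟨r, fun _ hq => hPr'' (hr (Finset.mem_coe.2 hq))⟩ +
                  sigma (cycLevel 3 0 r) (-1) (x 0 ⟨r, fun _ hq => hPr'' (hr (Finset.mem_coe.2 hq))⟩)))) -
              ((s : ℚ_[3]) ⊗ₜ[ℚ] (1 : CyclotomicField (cycLevel 3 0 r) ℚ)) =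
            (((3 : ℕ) : ℤ_[3]) ^ (m + 1)) • (l : ℚ_[3] ⊗[ℚ] CyclotomicField (cycLevel 3 0 r) ℚ)) ∧
          haveI : NeZero (∏ q ∈ r, Ideal.absNorm q.asIdeal) :=
            ⟨Finset.prod_ne_zero_iff.2 fun q _ h => q.ne_bot (Ideal.absNorm_eq_zero_iff.1 h)⟩
          PadicInt.toZModPow (m + 1) s = (u : ZMod (3 ^ (m + 1))) *
            ((3 : ℕ) : ZMod (3 ^ (m + 1))) ^ t *
              kuriharaNumber P.f (3 ^ (m + 1)) (∏ q ∈ r, Ideal.absNorm q.asIdeal) ψ) :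
    ∃ (κf : Finset (HeightOneSpectrum (𝓞 ℚ)) →
          galoisCohomology (W.torsionGaloisModule (((3 : ℕ) : ℤ) ^ k * ((3 : ℕ) : ℤ))) 1)
      (κu : Finset (HeightOneSpectrum (𝓞 ℚ)) →
          galoisCohomology (W.torsionGaloisModule (((3 : ℕ) : ℤ) ^ m * ((3 : ℕ) : ℤ))) 1),
      KatoKuriharaWitnessAtTwoExp W k t e D v₃ P κf Λk κf ∧
      KatoKuriharaWitnessAtTwoExp W m t e D'' v₃ P κu Λm κu ∧
      ∀ l, D''.IsLevel l → D.IsLevel l → galoisCohomology.map π 1 (κu l) = κf l := by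
  letI := TorsionCoeff.torsionBy.padicIntModule 3 (k + 1) (WeierstrassCurve.geomPoints W)
  letI := TorsionCoeff.torsionBy.padicIntModule 3 (m + 1) (WeierstrassCurve.geomPoints W)
  have hv₃p : ((primesEquiv v₃ : Nat.Primes) : ℕ) = 3 := primesEquiv_eq_of_natCast_mem Nat.prime_three hv₃
  -- the two coefficient systems `E[3^{j+1}]_{ℤ₃}` (GZ-2), reductions onto, pins `rfl`
  have hredk : Function.Surjective
      (tateModuleRed W 3 (W.continuous_galoisRepTate_holds 3) (k + 1)).hom := by
    intro y
    obtain ⟨b, hb⟩ := W.proj_surjective_of_isAlgClosed_holds 3 (k + 1) y.2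
    exact ⟨b, Subtype.ext hb⟩
  have hredm : Function.Surjective
      (tateModuleRed W 3 (W.continuous_galoisRepTate_holds 3) (m + 1)).hom := by
    intro y
    obtain ⟨b, hb⟩ := W.proj_surjective_of_isAlgClosed_holds 3 (m + 1) y.2
    exact ⟨b, Subtype.ext hb⟩
  -- THEOREM D-u PAIR-STABLE at the two depths for Kato's system `z`: ONE `σ`, (COMP); the place `3` by the
  -- auxiliary deeper families (`hstab`), the anomalous bad places by (C2) = `hbody.2.1`
  obtain ⟨σ, Φ, comm, κf, Φ'', comm'', κu, hσI, hσχ, hΦ, hΦ'', hKS, hKS'', -, -, hres, hres'', hcomp⟩ :=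
    KimAtThreeDeepLowerKolyvaginPairStable.exists_isKolyvaginSystem_pair_propagatedSelmerStructure_of_stable_of_unramified
      W (badPlaces c d A N) hkm hbody.1
      (tateModuleRed W 3 (W.continuous_galoisRepTate_holds 3) (k + 1)) hredk
      (fun y => pow_smul_eq_zero 3 (k + 1) _ y)
      (AddSubgroup.inclusion (geomTorsion_pow_succ_eq W 3 k).le : _ →+ _) continuous_of_discreteTopology
      (fun _ _ => rfl)
      (AddSubgroup.inclusion (geomTorsion_pow_succ_eq W 3 k).ge : _ →+ _) continuous_of_discreteTopology
      (fun y => Subtype.ext rfl) (fun y => Subtype.ext rfl) (fun _ => rfl)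
      (tateModuleRed W 3 (W.continuous_galoisRepTate_holds 3) (m + 1)) hredm
      (fun y => pow_smul_eq_zero 3 (m + 1) _ y)
      (AddSubgroup.inclusion (geomTorsion_pow_succ_eq W 3 m).le : _ →+ _) continuous_of_discreteTopology
      (fun _ _ => rfl)
      (AddSubgroup.inclusion (geomTorsion_pow_succ_eq W 3 m).ge : _ →+ _) continuous_of_discreteTopology
      (fun y => Subtype.ext rfl) (fun y => Subtype.ext rfl) (fun _ => rfl)
      π hπ hirr hstab D hT D'' hT'' hD hD'' hPr hPr'' hKol hKol'' hbody.2.1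
  refine ⟨κf, κu, ?_, ?_, fun l hl'' hl => hcomp l hl hl''⟩
  · -- depth `k`: (0), (I4) with `κ′ = κ`, (Λ) displayed, (DICT3₂) per level from the two-exponent value law
    refine ⟨fun l hl => hKS.mem_selmerGroup l hl,
      ⟨hKS, fun l _ => by rw [sub_self]; exact zero_mem _⟩, hΛk.1, hΛk.2, fun r hr => ?_⟩
    obtain ⟨s, u, ψ, hψ, hval, hw⟩ := hvalk σ hσI hσχ r hr
    have h2 := apply_localization_add_self_eq_toZModPow_of_derivativeFamily_twoExp W 3 P.f ι κK Λ c d a A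
      z x hbody hfin₂k (tateModuleRed W 3 (W.continuous_galoisRepTate_holds 3) (k + 1))
      (AddSubgroup.inclusion (geomTorsion_pow_succ_eq W 3 k).le : _ →+ _) continuous_of_discreteTopology
      (fun _ _ => rfl) (fun _ => rfl) D hPr σ Φ comm κf hΦ hKS hres hv₃p r hr s hval
    obtain ⟨u', hu'⟩ := exists_unit_mul_apply_eq_of_add_self 3 (by decide)
      (Λk.comp (galoisCohomology.localization
        (W.torsionGaloisModule (((3 : ℕ) : ℤ) ^ k * ((3 : ℕ) : ℤ))) (Sum.inr v₃) 1)) (κf r) u h2 hw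
    exact ⟨u', ψ, hψ, hu'⟩
  · -- depth `m`: the same
    refine ⟨fun l hl => hKS''.mem_selmerGroup l hl,
      ⟨hKS'', fun l _ => by rw [sub_self]; exact zero_mem _⟩, hΛm.1, hΛm.2, fun r hr => ?_⟩
    obtain ⟨s, u, ψ, hψ, hval, hw⟩ := hvalm σ hσI hσχ r hr
    have h2 := apply_localization_add_self_eq_toZModPow_of_derivativeFamily_twoExp W 3 P.f ι κK Λ c d a A
      z x hbody hfin₂m (tateModuleRed W 3 (W.continuous_galoisRepTate_holds 3) (m + 1))
      (AddSubgroup.inclusion (geomTorsion_pow_succ_eq W 3 m).le : _ →+ _) continuous_of_discreteTopology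
      (fun _ _ => rfl) (fun _ => rfl) D'' hPr'' σ Φ'' comm'' κu hΦ'' hKS'' hres'' hv₃p r hr s hval
    obtain ⟨u', hu'⟩ := exists_unit_mul_apply_eq_of_add_self 3 (by decide)
      (Λm.comp (galoisCohomology.localization
        (W.torsionGaloisModule (((3 : ℕ) : ℤ) ^ m * ((3 : ℕ) : ℤ))) (Sum.inr v₃) 1)) (κu r) u h2 hw
    exact ⟨u', ψ, hψ, hu'⟩

end Summit.BirchSwinnertonDyer.BirchSwinnertonDyer.Theorems.KimAtThreeTwoExponentWitnessPairStable

end
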